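import Summits.PneNP.PneNP.Theorems.RegularResolutionRung.Negative.OneSidedFalse

/-!
# `ResolutionUncertainty` (stmt-PneNP-9816) is FALSE on either side alone

Negative lemmas for the support item `Summit.PneNP.PneNP.Theses.RamseyUncertifiable.ResolutionUncertainty`
(load-bearing analysis first recorded by the cdisprove seat in `Cruxes/ResolutionUncertainty/Disproof.lean`;
here derived in three lines each from the regular rung's negative file
`RegularResolutionRung/Negative/OneSidedFalse.lean`, whose explicit short refutation of `Clique(∅ₙ, k)` is in
particular a dag-like refutation).

The item asks `n^{ε log₂ n} ≤ max |π₁| |π₂|` for resolution refutations `π₁` of the unary `Clique(G, ⌈log₂ n²⌉)`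
and `π₂` of `Clique(Gᶜ, ⌈log₂ n²⌉)`, for EVERY graph `G` on `n ≥ n₀` vertices.
* `WithoutComplement` / `WithoutGraph` — the item with the hypothesis on `π₂` (resp. `π₁`) dropped; each
  implies its regular-resolution analogue (`regularWithoutComplement_of_withoutComplement`, `…Graph…`), which
  is refuted there (`G = ⊥`, resp. `G = ⊤`, `n = 2^m`: a `2n²+n+2`-line refutation against `n^{ε log₂ n}`).
* `resolutionUncertainty_false_without_complement : ¬ WithoutComplement` (registered stub) and
  `resolutionUncertainty_false_without_graph : ¬ WithoutGraph` — so ANY proof of the item must use that BOTH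
  `G` and `Gᶜ` are `⌈log₂ n²⌉`-clique-free, i.e. genuine Ramsey structure; the `max` is where it enters.
* `not_resolutionUncertainty_iff` — the shape of a refutation of the item (pure logic).
[folklore; ABdRLNR21 arXiv:2012.09476 §9; LPRT arXiv:1303.3166 §1.1]
-/

-- the mandated namespace `Summit.PneNP.PneNP.…` (summit = problem = `PneNP`) repeats `PneNP` by design
set_option linter.dupNamespace false

namespace Summit.PneNP.PneNP.Theorems.ResolutionUncertainty.Negative

open Literature.Computability.Complexity Literature.Computability.MetaComplexity
open Summit.PneNP.PneNP.Theses.RamseyUncertifiable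
open Summit.PneNP.PneNP.Theorems.RegularResolutionRung.Negative

/-- The item with the hypothesis on `π₂` DROPPED: "every resolution refutation of `Clique(G, ⌈log₂ n²⌉)`
alone is quasi-polynomially long, for every graph `G`". -/
def WithoutComplement : Prop :=
  ∃ ε : ℝ, 0 < ε ∧ ∃ n₀ : ℕ, ∀ n ≥ n₀, ∀ (G : SimpleGraph (Fin n)) [DecidableRel G.Adj],
    ∀ π : List (ResLine ℕ),
      IsResRefutation (cliqueCNF n (Nat.clog 2 (n ^ 2)) fun u v => decide (G.Adj u v)) π →
      (n : ℝ) ^ (ε * Real.logb 2 n) ≤ (π.length : ℝ)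

/-- The item with the hypothesis on `π₁` DROPPED: "every resolution refutation of `Clique(Gᶜ, ⌈log₂ n²⌉)`
alone is quasi-polynomially long, for every graph `G`". -/
def WithoutGraph : Prop :=
  ∃ ε : ℝ, 0 < ε ∧ ∃ n₀ : ℕ, ∀ n ≥ n₀, ∀ (G : SimpleGraph (Fin n)) [DecidableRel G.Adj],
    ∀ π : List (ResLine ℕ),
      IsResRefutation (cliqueCNF n (Nat.clog 2 (n ^ 2)) fun u v => decide (Gᶜ.Adj u v)) π →
      (n : ℝ) ^ (ε * Real.logb 2 n) ≤ (π.length : ℝ)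

/-- A lower bound for all refutations is in particular one for all regular refutations. -/
theorem regularWithoutComplement_of_withoutComplement (h : WithoutComplement) :
    RegularResolutionRungWithoutComplement := by
  obtain ⟨ε, hε, n₀, h⟩ := h
  exact ⟨ε, hε, n₀, fun n hn G _ π h₁ _ => h n hn G π h₁⟩

/-- A lower bound for all refutations is in particular one for all regular refutations (graph side). -/
theorem regularWithoutGraph_of_withoutGraph (h : WithoutGraph) : RegularResolutionRungWithoutGraph := by
  obtain ⟨ε, hε, n₀, h⟩ := h
  exact ⟨ε, hε, n₀, fun n hn G _ π h₂ _ => h n hn G π h₂⟩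

/-- **Load-bearing: the complement side** (registered stub). Dropping `π₂` makes the item FALSE: the empty
graph `G = ⊥` on `n = 2^m` vertices has a (regular) refutation of `Clique(G, ⌈log₂ n²⌉)` with `2n² + n + 2`
lines, eventually below `n^{ε log₂ n}`. Any proof of the item must use that `Gᶜ` is clique-free too. -/
theorem resolutionUncertainty_false_without_complement : ¬ WithoutComplement :=
  fun h => regularResolutionRung_false_without_complement (regularWithoutComplement_of_withoutComplement h)

/-- **Load-bearing: the graph side.** Dropping `π₁` makes the item FALSE (the complete graph `G = ⊤`). -/
theorem resolutionUncertainty_false_without_graph : ¬ WithoutGraph :=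
  fun h => regularResolutionRung_false_without_graph (regularWithoutGraph_of_withoutGraph h)

/-- **The shape of a refutation of the item** (pure logic): for every `ε > 0` beyond every `n₀`, a graph
with SHORT refutations on BOTH sides at once — necessarily a `⌈log₂ n²⌉`-Ramsey graph, since otherwise one of
the two formulas is satisfiable and has no refutation (soundness). -/
theorem not_resolutionUncertainty_iff :
    ¬ ResolutionUncertainty ↔ ∀ ε : ℝ, 0 < ε → ∀ n₀ : ℕ, ∃ n ≥ n₀, ∃ (G : SimpleGraph (Fin n)) (_ : DecidableRel G.Adj),
      ∃ π₁ π₂ : List (ResLine ℕ),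
        IsResRefutation (cliqueCNF n (Nat.clog 2 (n ^ 2)) fun u v => decide (G.Adj u v)) π₁ ∧
        IsResRefutation (cliqueCNF n (Nat.clog 2 (n ^ 2)) fun u v => decide (Gᶜ.Adj u v)) π₂ ∧
        max (π₁.length : ℝ) (π₂.length : ℝ) < (n : ℝ) ^ (ε * Real.logb 2 n) := by
  have e : ResolutionUncertainty ↔
      ∃ ε : ℝ, 0 < ε ∧ ∃ n₀ : ℕ, ∀ n ≥ n₀, ∀ (G : SimpleGraph (Fin n)) [DecidableRel G.Adj],
        ∀ π₁ π₂ : List (ResLine ℕ),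
          IsResRefutation (cliqueCNF n (Nat.clog 2 (n ^ 2)) fun u v => decide (G.Adj u v)) π₁ →
          IsResRefutation (cliqueCNF n (Nat.clog 2 (n ^ 2)) fun u v => decide (Gᶜ.Adj u v)) π₂ →
          (n : ℝ) ^ (ε * Real.logb 2 n) ≤ max (π₁.length : ℝ) (π₂.length : ℝ) := Iff.rfl
  rw [e]
  push Not
  rfl

end Summit.PneNP.PneNP.Theorems.ResolutionUncertainty.Negative
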